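import Summits.PneNP.PneNP.Theorems.KarlinRubinMonotoneBlindDnfBounds

/-!
# Route KarlinRubin, crux `MonotoneBlind` (stmt-PneNP-18027): local-OR blindness, per-`n` part

Extension of the DNF line (same engine, NO monotonicity needed): an OR `f = ⋁_{i<m} g_i` of arbitrary tests, each
`g_i` depending only on the edge slots inside a vertex set `V_i`. The witness lemma for slot-supported tests
(`localOr_witness_count`): if every `i ∈ Light` has `V_i` meeting `A` in a set spanning `≤ t` slots, then
`#{x : ∃ i ∈ Light, g_i (plant A x)} ≤ 2^t · #{x : ∃ i ∈ Light, g_i x}` (in the fibre of `y = plant A x` force the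
`≤ t` slots inside `A ∩ V_{i₀}` on; the test `g_{i₀}` then sees exactly `y`). With threshold `t = C(j-1,2)`, a heavy
index has `|A ∩ V_i| ≥ j`, so (`localOr_planted_le`)
`Pr_planted[f = 1] ≤ 2^t · Pr_null[f = 1] + Σ_i C(|V_i|, j) d^j / n^j`, `d = min k n` — and with `|V_i| ≤ v`,
`(v d)^q · n ≤ n^q`, `j = q(c+2)`, `m ≤ n^c`, the sum is `≤ (n²)⁻¹` (`localOr_planted_le_null_add`). Asymptotics and the
theorem are in `KarlinRubinMonotoneBlindLocalOrBlind.lean`. (Imports the DNF line up to its numeric level only.)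

All `--supports stmt-PneNP-18027`; no definitions.
-/

set_option linter.dupNamespace false -- `Summit.PneNP.PneNP.…`: summit = sub-problem (D-0017)

namespace Summit.PneNP.PneNP.Theorems

open Finset
open scoped ENNReal
open Literature.Computability.Complexity
open Literature.Probability.RandomGraphs.PlantedClique

variable {n : ℕ}

/-! ### Slots inside `A ∩ V` -/

/-- The slots inside both `A` and `V` are at most `C(|A ∩ V|, 2)`. [folklore] -/
theorem card_filter_inside_inside_le_choose (A V : Finset (Fin n)) :
    #(univ.filter fun e : (⊤ : SimpleGraph (Fin n)).edgeSet =>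
        (∀ v ∈ (e : Sym2 (Fin n)), v ∈ A) ∧ ∀ v ∈ (e : Sym2 (Fin n)), v ∈ V) ≤ (#(A ∩ V)).choose 2 := by
  classical
  set E := univ.filter fun e : (⊤ : SimpleGraph (Fin n)).edgeSet => ∀ v ∈ (e : Sym2 (Fin n)), v ∈ V with hE
  have hfilter : (univ.filter fun e : (⊤ : SimpleGraph (Fin n)).edgeSet =>
      (∀ v ∈ (e : Sym2 (Fin n)), v ∈ A) ∧ ∀ v ∈ (e : Sym2 (Fin n)), v ∈ V) =
      E.filter fun e : (⊤ : SimpleGraph (Fin n)).edgeSet => ∀ v ∈ (e : Sym2 (Fin n)), v ∈ A := by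
    ext e; simp only [hE, mem_filter, mem_univ, true_and]; tauto
  rw [hfilter]
  refine (card_filter_inside_le_choose A E).trans (Nat.choose_le_choose 2 (card_le_card ?_))
  intro v hv
  rw [mem_inter] at hv ⊢
  refine ⟨hv.1, ?_⟩
  have h2 := (mem_filter.1 hv.2).2
  obtain ⟨e, he, hve⟩ := h2
  exact (mem_filter.1 he).2 v hve

/-! ### The witness lemma for slot-supported tests -/

/-- **Witness lemma for slot-supported tests (counting form).** Let `g i` depend only on the slots inside `V i`,
and let every `i ∈ Light` have at most `t` slots inside `A ∩ V i`. Then the inputs whose PLANTED graph passes some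
light test are at most `2^t` times as many as the inputs passing some light test themselves: in the fibre of
`y = plant A x` containing a witness `i₀`, switching on the `≤ t` slots inside `A ∩ V_{i₀}` yields an input that
agrees with `y` on every slot inside `V_{i₀}`. No monotonicity is used. [folklore] -/
theorem localOr_witness_count (A : Finset (Fin n)) {m : ℕ} (g : Fin m → EdgeVec n → Bool)
    (V : Fin m → Finset (Fin n))
    (hsupp : ∀ i x y, (∀ e : (⊤ : SimpleGraph (Fin n)).edgeSet,
      (∀ v ∈ (e : Sym2 (Fin n)), v ∈ V i) → x e = y e) → g i x = g i y)
    (Light : Finset (Fin m)) (t : ℕ)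
    (ht : ∀ i ∈ Light, #(univ.filter fun e : (⊤ : SimpleGraph (Fin n)).edgeSet =>
        (∀ v ∈ (e : Sym2 (Fin n)), v ∈ A) ∧ ∀ v ∈ (e : Sym2 (Fin n)), v ∈ V i) ≤ t) :
    #(univ.filter fun x : EdgeVec n => ∃ i ∈ Light, g i (plant A x) = true) ≤
      2 ^ t * #(univ.filter fun x : EdgeVec n => ∃ i ∈ Light, g i x = true) := by
  classical
  set L := univ.filter fun x : EdgeVec n => ∃ i ∈ Light, g i (plant A x) = true with hL
  set R := univ.filter fun x : EdgeVec n => ∃ i ∈ Light, g i x = true with hR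
  rw [card_eq_sum_card_fiberwise (f := plant A) (t := (univ : Finset (EdgeVec n))) fun _ _ => mem_univ _,
    card_eq_sum_card_fiberwise (f := plant A) (s := R) (t := (univ : Finset (EdgeVec n)))
      fun _ _ => mem_univ _, mul_sum]
  refine sum_le_sum fun y _ => ?_
  by_cases hLy : (L.filter fun x => plant A x = y) = ∅
  · rw [hLy, card_empty]; exact Nat.zero_le _
  obtain ⟨x₀, hx₀⟩ := nonempty_iff_ne_empty.2 hLy
  rw [mem_filter, hL, mem_filter] at hx₀
  obtain ⟨⟨-, i₀, hi₀, hi₀y⟩, hx₀y⟩ := hx₀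
  have hyA : ∀ e : (⊤ : SimpleGraph (Fin n)).edgeSet, (∀ v ∈ (e : Sym2 (Fin n)), v ∈ A) → y e = true := by
    intro e he; rw [← hx₀y]; exact plant_apply_of_inside A x₀ e he
  have hgy : g i₀ y = true := by rw [← hx₀y]; exact hi₀y
  -- the slots inside `A ∩ V i₀`
  set D := univ.filter fun e : (⊤ : SimpleGraph (Fin n)).edgeSet =>
    (∀ v ∈ (e : Sym2 (Fin n)), v ∈ A) ∧ ∀ v ∈ (e : Sym2 (Fin n)), v ∈ V i₀ with hD
  have hDt : #D ≤ t := ht i₀ hi₀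
  set Fib := univ.filter fun x : EdgeVec n => plant A x = y with hFib
  let φ : EdgeVec n → EdgeVec n := fun x e => if e ∈ D then true else x e
  have hφ_off : ∀ x e, e ∉ D → φ x e = x e := fun x e he => by simp [φ, he]
  have hφ_on : ∀ x e, e ∈ D → φ x e = true := fun x e he => by simp [φ, he]
  have hplant_φ : ∀ x ∈ Fib, plant A (φ x) = y := by
    intro x hx
    rw [hFib, mem_filter] at hx
    funext e
    by_cases he : ∀ v ∈ (e : Sym2 (Fin n)), v ∈ A
    · rw [plant_apply_of_inside A _ e he, hyA e he]
    · have heD : e ∉ D := fun h => he (mem_filter.1 h).2.1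
      rw [plant_apply_of_not_inside A _ e he, hφ_off x e heD, ← plant_apply_of_not_inside A x e he, hx.2]
  have hgφ : ∀ x ∈ Fib, g i₀ (φ x) = true := by
    intro x hx
    rw [hFib, mem_filter] at hx
    rw [← hgy]
    refine hsupp i₀ (φ x) y fun e heV => ?_
    by_cases heA : ∀ v ∈ (e : Sym2 (Fin n)), v ∈ A
    · rw [hφ_on x e (mem_filter.2 ⟨mem_univ _, heA, heV⟩), hyA e heA]
    · have heD : e ∉ D := fun h => heA (mem_filter.1 h).2.1
      rw [hφ_off x e heD, ← plant_apply_of_not_inside A x e heA, hx.2]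
  have himage : Fib.image φ ⊆ R.filter fun x => plant A x = y := by
    intro z hz
    rw [mem_image] at hz
    obtain ⟨x, hx, rfl⟩ := hz
    rw [mem_filter, hR, mem_filter]
    exact ⟨⟨mem_univ _, i₀, hi₀, hgφ x hx⟩, hplant_φ x hx⟩
  have hfibre : ∀ z ∈ Fib.image φ, #(Fib.filter fun x => φ x = z) ≤ 2 ^ t := by
    intro z _
    calc #(Fib.filter fun x => φ x = z)
        ≤ #(univ.filter fun x : EdgeVec n => ∀ e, e ∉ D → x e = z e) := by
          refine card_le_card fun x hx => ?_
          rw [mem_filter] at hx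
          rw [mem_filter]
          refine ⟨mem_univ _, fun e he => ?_⟩
          rw [← hx.2, hφ_off x e he]
      _ ≤ 2 ^ #D := card_filter_eq_off_le D z
      _ ≤ 2 ^ t := Nat.pow_le_pow_right two_pos hDt
  calc #(L.filter fun x => plant A x = y)
      ≤ #Fib := card_le_card fun x hx => by
          rw [mem_filter] at hx; rw [hFib, mem_filter]; exact ⟨mem_univ _, hx.2⟩
    _ ≤ 2 ^ t * #(Fib.image φ) := card_le_mul_card_image _ _ hfibre
    _ ≤ 2 ^ t * #(R.filter fun x => plant A x = y) := Nat.mul_le_mul_left _ (card_le_card himage)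

/-! ### The master inequality for local ORs -/

/-- **Local-OR master inequality.** For tests `g i` supported on the slots inside `V i` and every `j`, the planted
acceptance of `f = ⋁ᵢ g i` is at most `2^{C(j-1,2)}` times its null acceptance plus `Σᵢ C(|V i|, j) d^j / n^j`
(`d = min k n`, `0 < n`): indices with `|A ∩ V i| ≤ j - 1` are light (`≤ C(j-1,2)` slots inside `A ∩ V i`) and go
through the witness lemma; the others are charged `1` and bounded by the hypergeometric tail. [folklore] -/
theorem localOr_planted_le (hn : 0 < n) (k j : ℕ) {m : ℕ} (g : Fin m → EdgeVec n → Bool)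
    (V : Fin m → Finset (Fin n))
    (hsupp : ∀ i x y, (∀ e : (⊤ : SimpleGraph (Fin n)).edgeSet,
      (∀ v ∈ (e : Sym2 (Fin n)), v ∈ V i) → x e = y e) → g i x = g i y) :
    (plantedCliqueDist n k).toOuterMeasure {x | ∃ i, g i x = true} ≤
      2 ^ ((j - 1).choose 2) * (erdosRenyiHalf n).toOuterMeasure {x | ∃ i, g i x = true} +
        ∑ i, (((#(V i)).choose j * (min k n) ^ j : ℕ) : ℝ≥0∞) / ((n ^ j : ℕ) : ℝ≥0∞) := by
  classical
  set KS := kSubsets n k with hKS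
  set P0 := erdosRenyiHalf n with hP0
  set t := (j - 1).choose 2 with ht
  set μ := P0.toOuterMeasure {x | ∃ i, g i x = true} with hμ
  -- per planted set
  have hA : ∀ A ∈ KS, P0.toOuterMeasure {x | plant A x ∈ {x : EdgeVec n | ∃ i, g i x = true}} ≤
      2 ^ t * μ + ∑ i, if j ≤ #(A ∩ V i) then (1 : ℝ≥0∞) else 0 := by
    intro A _
    set Light := univ.filter fun i : Fin m => #(A ∩ V i) ≤ j - 1 with hLight
    have hsplit : {x | plant A x ∈ {x : EdgeVec n | ∃ i, g i x = true}} ⊆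
        {x | ∃ i ∈ Light, g i (plant A x) = true} ∪
          ⋃ i ∈ (univ.filter fun i : Fin m => j ≤ #(A ∩ V i)), (Set.univ : Set (EdgeVec n)) := by
      intro x hx
      simp only [Set.mem_setOf_eq] at hx
      obtain ⟨i, hi⟩ := hx
      by_cases hle : #(A ∩ V i) ≤ j - 1
      · exact Or.inl ⟨i, mem_filter.2 ⟨mem_univ _, hle⟩, hi⟩
      · refine Or.inr (Set.mem_biUnion (x := i) ?_ (Set.mem_univ x))
        exact mem_filter.2 ⟨mem_univ _, by omega⟩
    have hlight : P0.toOuterMeasure {x | ∃ i ∈ Light, g i (plant A x) = true} ≤ 2 ^ t * μ := by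
      have hcount := localOr_witness_count A g V hsupp Light t (fun i hi => by
        refine (card_filter_inside_inside_le_choose A (V i)).trans ?_
        rw [ht]
        exact Nat.choose_le_choose 2 (mem_filter.1 hi).2)
      have hcount' : #(univ.filter fun x : EdgeVec n =>
            x ∈ {x : EdgeVec n | ∃ i ∈ Light, g i (plant A x) = true}) ≤
          2 ^ t * #(univ.filter fun x : EdgeVec n => x ∈ {x : EdgeVec n | ∃ i, g i x = true}) := by
        refine le_trans (by simpa only [Set.mem_setOf_eq] using hcount) (Nat.mul_le_mul_left _ ?_)
        refine card_le_card fun x hx => ?_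
        simp only [mem_filter, mem_univ, true_and, Set.mem_setOf_eq] at hx ⊢
        obtain ⟨i, -, hi⟩ := hx
        exact ⟨i, hi⟩
      have h := erdosRenyiHalf_le_mul_of_card_le
        {x : EdgeVec n | ∃ i ∈ Light, g i (plant A x) = true}
        {x : EdgeVec n | ∃ i, g i x = true} (2 ^ t) hcount'
      rw [hμ, hP0]
      convert h using 2
      push_cast
      rfl
    have hheavy : P0.toOuterMeasure (⋃ i ∈ (univ.filter fun i : Fin m => j ≤ #(A ∩ V i)),
        (Set.univ : Set (EdgeVec n))) ≤ ∑ i, if j ≤ #(A ∩ V i) then (1 : ℝ≥0∞) else 0 := by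
      calc P0.toOuterMeasure (⋃ i ∈ (univ.filter fun i : Fin m => j ≤ #(A ∩ V i)), (Set.univ : Set (EdgeVec n)))
          ≤ ∑ i ∈ univ.filter (fun i : Fin m => j ≤ #(A ∩ V i)), P0.toOuterMeasure (Set.univ : Set (EdgeVec n)) :=
            MeasureTheory.measure_biUnion_finset_le _ _
        _ ≤ ∑ i ∈ univ.filter (fun i : Fin m => j ≤ #(A ∩ V i)), (1 : ℝ≥0∞) :=
            sum_le_sum fun i _ => (PMF.toOuterMeasure_apply_eq_one_iff _ _).2 (Set.subset_univ _) |>.le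
        _ = ∑ i, if j ≤ #(A ∩ V i) then (1 : ℝ≥0∞) else 0 := by rw [sum_filter]
    calc P0.toOuterMeasure {x | plant A x ∈ {x : EdgeVec n | ∃ i, g i x = true}}
        ≤ P0.toOuterMeasure ({x | ∃ i ∈ Light, g i (plant A x) = true} ∪
            ⋃ i ∈ (univ.filter fun i : Fin m => j ≤ #(A ∩ V i)), (Set.univ : Set (EdgeVec n))) :=
          P0.toOuterMeasure.mono hsplit
      _ ≤ _ := MeasureTheory.measure_union_le _ _
      _ ≤ _ := add_le_add hlight hheavy
  -- average over `A`
  have hne := card_kSubsets_cast_ne_zero n k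
  have htop : ((#KS : ℕ) : ℝ≥0∞) ≠ ⊤ := ENNReal.natCast_ne_top _
  rw [plantedCliqueDist_toOuterMeasure_eq_sum]
  calc ((#KS : ℕ) : ℝ≥0∞)⁻¹ * ∑ A ∈ KS, P0.toOuterMeasure {x | plant A x ∈ {x : EdgeVec n | ∃ i, g i x = true}}
      ≤ ((#KS : ℕ) : ℝ≥0∞)⁻¹ * ∑ A ∈ KS, (2 ^ t * μ + ∑ i, if j ≤ #(A ∩ V i) then (1 : ℝ≥0∞) else 0) := by
        gcongr with A hAKS
        exact hA A hAKS
    _ = 2 ^ t * μ + ∑ i, ((#KS : ℕ) : ℝ≥0∞)⁻¹ * ∑ A ∈ KS, (if j ≤ #(A ∩ V i) then (1 : ℝ≥0∞) else 0) := by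
        rw [sum_add_distrib, sum_const, nsmul_eq_mul, mul_add, ← mul_assoc,
          ENNReal.inv_mul_cancel hne htop, one_mul, sum_comm, mul_sum]
    _ ≤ 2 ^ t * μ + ∑ i, (((#(V i)).choose j * (min k n) ^ j : ℕ) : ℝ≥0∞) / ((n ^ j : ℕ) : ℝ≥0∞) := by
        gcongr with i _
        refine le_trans (avg_kSubsets_le_card_filter k _ (fun A => j ≤ #(A ∩ V i)) fun A _ => le_rfl) ?_
        exact avg_kSubsets_card_inter_ge_le hn k j (V i)

/-! ### Numeric form with polynomially many local tests -/

/-- **Small vertex supports.** If `v ≤ vmax` and `(vmax · d)^q · n ≤ n^q` then, with `j = q (c+2)`,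
`C(v, j) d^j / n^j ≤ (n^{c+2})⁻¹`. [folklore] -/
theorem localOr_term_le_inv {v vmax d q c : ℕ} (hn : 0 < n) (hv : v ≤ vmax) (H : (vmax * d) ^ q * n ≤ n ^ q) :
    ((v.choose (q * (c + 2)) * d ^ (q * (c + 2)) : ℕ) : ℝ≥0∞) / ((n ^ (q * (c + 2)) : ℕ) : ℝ≥0∞) ≤
      (((n ^ (c + 2) : ℕ) : ℝ≥0∞))⁻¹ := by
  refine natCast_div_le_inv_of_mul_le ?_ (pow_pos hn _).ne'
  -- `(vmax d)^{q(c+2)} n^{c+2} ≤ n^{q(c+2)}`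
  have hstep : ((vmax * d) ^ q) ^ (c + 2) * n ^ (c + 2) ≤ (n ^ q) ^ (c + 2) := by
    rw [← mul_pow]
    exact Nat.pow_le_pow_left H _
  calc v.choose (q * (c + 2)) * d ^ (q * (c + 2)) * n ^ (c + 2)
      ≤ v ^ (q * (c + 2)) * d ^ (q * (c + 2)) * n ^ (c + 2) := by
        gcongr; exact Nat.choose_le_pow _ _
    _ ≤ vmax ^ (q * (c + 2)) * d ^ (q * (c + 2)) * n ^ (c + 2) := by gcongr
    _ = ((vmax * d) ^ q) ^ (c + 2) * n ^ (c + 2) := by ring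
    _ ≤ (n ^ q) ^ (c + 2) := hstep
    _ = n ^ (q * (c + 2)) := by rw [← pow_mul]

/-- **Per-`n` bound for local ORs.** With `m ≤ n^c` tests supported on vertex sets of size `≤ vmax`,
`(vmax d)^q n ≤ n^q` and `j = q(c+2)`: planted acceptance `≤ 2^{C(j-1,2)} · null acceptance + (n²)⁻¹`. [folklore] -/
theorem localOr_planted_le_null_add (hn : 0 < n) (k : ℕ) {q c vmax m : ℕ} (g : Fin m → EdgeVec n → Bool)
    (V : Fin m → Finset (Fin n))
    (hsupp : ∀ i x y, (∀ e : (⊤ : SimpleGraph (Fin n)).edgeSet,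
      (∀ v ∈ (e : Sym2 (Fin n)), v ∈ V i) → x e = y e) → g i x = g i y)
    (hV : ∀ i, #(V i) ≤ vmax) (H : (vmax * (min k n)) ^ q * n ≤ n ^ q) (hm : m ≤ n ^ c) :
    (plantedCliqueDist n k).toOuterMeasure {x | ∃ i, g i x = true} ≤
      2 ^ ((q * (c + 2) - 1).choose 2) * (erdosRenyiHalf n).toOuterMeasure {x | ∃ i, g i x = true} +
        (((n ^ 2 : ℕ) : ℝ≥0∞))⁻¹ := by
  refine (localOr_planted_le hn k (q * (c + 2)) g V hsupp).trans ?_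
  gcongr
  calc ∑ i, (((#(V i)).choose (q * (c + 2)) * (min k n) ^ (q * (c + 2)) : ℕ) : ℝ≥0∞) /
        ((n ^ (q * (c + 2)) : ℕ) : ℝ≥0∞)
      ≤ ∑ _i : Fin m, (((n ^ (c + 2) : ℕ) : ℝ≥0∞))⁻¹ :=
        sum_le_sum fun i _ => localOr_term_le_inv hn (hV i) H
    _ = (m : ℝ≥0∞) * (((n ^ (c + 2) : ℕ) : ℝ≥0∞))⁻¹ := by
        rw [sum_const, card_univ, Fintype.card_fin, nsmul_eq_mul]
    _ ≤ ((n ^ c : ℕ) : ℝ≥0∞) * (((n ^ (c + 2) : ℕ) : ℝ≥0∞))⁻¹ :=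
        mul_le_mul' (by exact_mod_cast hm) le_rfl
    _ = (((n ^ 2 : ℕ) : ℝ≥0∞))⁻¹ := by
        -- `n^c · (n^{c+2})⁻¹ = (n²)⁻¹`
        have h0 : ((n ^ c : ℕ) : ℝ≥0∞) ≠ 0 := by exact_mod_cast (pow_pos hn c).ne'
        have htop : ((n ^ c : ℕ) : ℝ≥0∞) ≠ ⊤ := ENNReal.natCast_ne_top _
        have hsplit : ((n ^ (c + 2) : ℕ) : ℝ≥0∞) = ((n ^ c : ℕ) : ℝ≥0∞) * ((n ^ 2 : ℕ) : ℝ≥0∞) := by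
          rw [pow_add, Nat.cast_mul]
        rw [hsplit, ENNReal.mul_inv (Or.inl h0) (Or.inl htop), ← mul_assoc, ENNReal.mul_inv_cancel h0 htop,
          one_mul]

end Summit.PneNP.PneNP.Theorems
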